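import Summits.BirchSwinnertonDyer.BirchSwinnertonDyer.Theorems.ByReductionTypeAtTwoRankOneAtTwoBigImageOddLocalOneDoorHalvesKSlice
import HarnessLib

/-!
# Route ByReductionTypeAtTwo, crux `RankOneAtTwoBigImageOddLocal` (stmt-BirchSwinnertonDyer-23715), LINE v8.5 `one_door_analytic`:
# the K-side HALVES are LOSSLESS — each half of `BSD₂(W)` gives back the corresponding one-sided K-statement

Width prover seat `bsd-line-fkl-p2` g8 (2026-08-28), `--supports stmt-BirchSwinnertonDyer-23715`.  THEOREMS ONLY; nothing is asserted;
BSD is not proved by any of this.  Sequel of `…OneDoorHalvesK.lean` / `…OneDoorHalvesKSlice.lean`.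

g7's `…OneDoorKolyvaginExactBridgeCLossless.lean` (p624342) shows that the exact K-side binder hXC is EQUIVALENT to `BSD₂` on the slice
modulo PRINT and rank-`0` `BSD₂`.  The same holds half by half:

* §1 per datum: `card_sha_baseChange_le_C_of_missingUpperBoundAt` — the Euler-system half `ord₂ #Ш(W) ≤ ord₂ #Ш_an(W)` GIVES BACK
  Kolyvagin's inequality `ord₂ #Ш(E_K)[2^∞] + 2·v₂(c) ≤ 2·M₀` at every conductor-`1` datum of any constant on the slice (the defect
  transports up, `missingUpperBoundAt_iff_upperOverC_baseChange`; `ord₂ #Ш_an(E_K) = 2·M₀ − 2·v₂(c)`,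
  `exists_shaAnOverC_baseChange_padicValRat_eq_C`); `card_sha_baseChange_ge_C_of_missingLowerBoundAt` dually.
* §2 on the slice: `missingUpperBoundAt_onSlice_iff_shaUpperCAtTwo` — modulo PRINT (`gross_zagier`, GZK, `exists_isNewformOf`,
  Hoffstein–Luo, Milne 1972) and `S_rankZeroTwin`, **(the Euler-system half of `BSD₂` on the whole slice) ⟺ hXU′** (Kolyvagin's upper
  bound at `2`, c-corrected, at conductor `1`, on the Kolyvagin-admissible doors of slice curves — hXU carrying the slice's odd-torsion
  binder, as in g7's `rankOneAtTwoBigImageOddLocal_iff_shaExactCAtTwo`); `missingLowerBoundAt_onSlice_iff_shaLowerCAtTwo` dually.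

So the split of 23715 into halves loses nothing: Euler-system half ⟺ hXU′, main-conjecture half ⟺ hXL′, crux ⟺ both.  Conditional
by design throughout.

References: [GrossLMS1991] Thm. 1.3, §2 Conj. (2.2), §4; [Milne1972ArithmeticAV] §1 Thm. 1; [Miller2011LMS] Def. 1.1.
-/

set_option autoImplicit false
-- the Theorems namespace of this sub repeats the summit name by design (D-0017 nested layout)
set_option linter.dupNamespace false

noncomputable section

open scoped Classical

namespace Summit.BirchSwinnertonDyer.BirchSwinnertonDyer.Theorems.RankOneAtTwoOneDoor

open WeierstrassCurve NumberField Literature.NumberTheory.EllipticCurves Literature.NumberTheory.EllipticCurves.ModularForms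
  Literature.NumberTheory.EllipticCurves.Rank1Residual
  Literature.NumberTheory.EllipticCurves.Rank1Residual.Typed
  Literature.NumberTheory.EllipticCurves.KrizLi2019
  Summit.BirchSwinnertonDyer.Rank1Residual
  Summit.BirchSwinnertonDyer.Rank1Residual.AdditivePotMult
  Summit.BirchSwinnertonDyer.Rank1Residual.F1Sign2
  Summit.BirchSwinnertonDyer.Rank1Residual.F1Sign2.TranspositionDoor
  Summit.BirchSwinnertonDyer.BirchSwinnertonDyer.Theses.ByReductionTypeAtTwo
  Summit.BirchSwinnertonDyer.BirchSwinnertonDyer.Theorems.CMExactDescent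

/-! ### §1 Losslessness of the split, per datum -/

/-- **The upper half GIVES BACK the `≤`-binder** at every conductor-`1` datum on the slice: `MissingUpperBoundAt W 2` ⟹
`ord₂ #Ш(E_K)[2^∞] + 2·v₂(c) ≤ 2·M₀` (modulo the same PRINT and `S_rankZeroTwin`): the defect transports up
(`missingUpperBoundAt_iff_upperOverC_baseChange`) and `ord₂ #Ш_an(E_K) = 2·M₀ − 2·v₂(c)` (`exists_shaAnOverC_baseChange_padicValRat_eq_C`).
[cite: GrossLMS1991, §2 Conj. (2.2)] [cite: Milne1972ArithmeticAV, §1 Thm. 1] -/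
theorem card_sha_baseChange_le_C_of_missingUpperBoundAt
    (hGZ : ∀ (N : ℕ) [NeZero N] (W : WeierstrassCurve ℚ) (K : Type) [Field K] [NumberField K], gross_zagier N W K)
    (hGZK : rank_eq_analyticRank_of_analyticRank_le_one) (hmod : hasEntireLFunction_rat)
    (hMilneC : Milne1972.bsdQuotient_baseChange_quadratic_anyModel) (hZ : S_rankZeroTwin)
    (W : WeierstrassCurve ℚ) [W.IsElliptic] [W.IsGloballyMinimal] [NeZero (W.conductorNorm ℤ)]
    (hCM : ¬ W.HasCM) (hsurj : ∀ n : ℕ, W.HasSurjectiveModNGaloisRep ((2 ^ n : ℕ) : ℤ)) (hc : Odd W.tamagawaProduct)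
    (hr : W.analyticRank = 1)
    (K : Type) [Field K] [NumberField K] (hK : IsImaginaryQuadratic K) (hodd : Odd (NumberField.discr K))
    (h3 : NumberField.discr K ≠ -3) (hH : SatisfiesHeegnerHypothesis (W.conductorNorm ℤ) K)
    (Dt : ModularParametrizationData W (W.conductorNorm ℤ)) (β : ℤ) (ι : K →+* ℂ)
    (d₁ : KolyvaginHeegnerData Dt β ι 1) (hy : ¬ IsOfFinAddOrder d₁.derivedPoint)
    (M₀ : ℕ)
    (hdiv : ∃ Q : (W.baseChange (ringClassField K ι 1)).toAffine.Point, ((2 ^ M₀ : ℕ) : ℤ) • Q = d₁.derivedPoint)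
    (hndiv : ¬ ∃ Q : (W.baseChange (ringClassField K ι 1)).toAffine.Point,
      ((2 ^ (M₀ + 1) : ℕ) : ℤ) • Q = d₁.derivedPoint) (hU : MissingUpperBoundAt W 2) :
    (padicValNat 2 (Nat.card (AddCommGroup.primaryComponent (W.baseChange K).sha 2)) : ℤ) + 2 * padicValInt 2 Dt.c ≤ 2 * M₀ := by
  haveI : Fact (Nat.Prime 2) := ⟨Nat.prime_two⟩
  obtain ⟨hρ2, Cd, _, _, hBd⟩ := exists_minimalTwin_bsdp_at hGZ hmod hZ W hCM hsurj hr K hK hH Dt β ι d₁ hy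
  obtain ⟨hrd, hrK⟩ := analyticRank_twin_and_baseChange_of_rankOne W K Dt β ι d₁ (Cd • W.quadraticTwist (NumberField.discr K : ℚ))
    (hGZ _ W K) hmod hK hH hr hy ⟨Cd, rfl⟩
  obtain ⟨-, hshaV, q, hq, hval⟩ := exists_shaAnOverC_baseChange_padicValRat_eq_C W K Dt β ι d₁ (hGZ _ W K) hGZK hmod hρ2 hc hK hodd
    h3 hH hrK hdiv hndiv
  obtain ⟨q', hq', hle⟩ := (missingUpperBoundAt_iff_upperOverC_baseChange W 2 K (Cd • W.quadraticTwist (NumberField.discr K : ℚ)) hGZK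
    hmod hMilneC hr.le hK.1 ⟨Cd, rfl⟩ (by rw [hrd]; exact zero_le_one) hBd).mp hU
  have hqq : q' = q := by exact_mod_cast hq'.symm.trans hq
  rw [hqq, hval, hshaV] at hle
  linarith

/-- **The lower half GIVES BACK the `≥`-binder** at every conductor-`1` datum on the slice (dual of
`card_sha_baseChange_le_C_of_missingUpperBoundAt`). [cite: GrossLMS1991, §2 Conj. (2.2)] [cite: Milne1972ArithmeticAV, §1 Thm. 1] -/
theorem card_sha_baseChange_ge_C_of_missingLowerBoundAt
    (hGZ : ∀ (N : ℕ) [NeZero N] (W : WeierstrassCurve ℚ) (K : Type) [Field K] [NumberField K], gross_zagier N W K)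
    (hGZK : rank_eq_analyticRank_of_analyticRank_le_one) (hmod : hasEntireLFunction_rat)
    (hMilneC : Milne1972.bsdQuotient_baseChange_quadratic_anyModel) (hZ : S_rankZeroTwin)
    (W : WeierstrassCurve ℚ) [W.IsElliptic] [W.IsGloballyMinimal] [NeZero (W.conductorNorm ℤ)]
    (hCM : ¬ W.HasCM) (hsurj : ∀ n : ℕ, W.HasSurjectiveModNGaloisRep ((2 ^ n : ℕ) : ℤ)) (hc : Odd W.tamagawaProduct)
    (hr : W.analyticRank = 1)
    (K : Type) [Field K] [NumberField K] (hK : IsImaginaryQuadratic K) (hodd : Odd (NumberField.discr K))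
    (h3 : NumberField.discr K ≠ -3) (hH : SatisfiesHeegnerHypothesis (W.conductorNorm ℤ) K)
    (Dt : ModularParametrizationData W (W.conductorNorm ℤ)) (β : ℤ) (ι : K →+* ℂ)
    (d₁ : KolyvaginHeegnerData Dt β ι 1) (hy : ¬ IsOfFinAddOrder d₁.derivedPoint)
    (M₀ : ℕ)
    (hdiv : ∃ Q : (W.baseChange (ringClassField K ι 1)).toAffine.Point, ((2 ^ M₀ : ℕ) : ℤ) • Q = d₁.derivedPoint)
    (hndiv : ¬ ∃ Q : (W.baseChange (ringClassField K ι 1)).toAffine.Point,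
      ((2 ^ (M₀ + 1) : ℕ) : ℤ) • Q = d₁.derivedPoint) (hL : MissingLowerBoundAt W 2) :
    2 * (M₀ : ℤ) ≤ (padicValNat 2 (Nat.card (AddCommGroup.primaryComponent (W.baseChange K).sha 2)) : ℤ) + 2 * padicValInt 2 Dt.c := by
  haveI : Fact (Nat.Prime 2) := ⟨Nat.prime_two⟩
  obtain ⟨hρ2, Cd, _, _, hBd⟩ := exists_minimalTwin_bsdp_at hGZ hmod hZ W hCM hsurj hr K hK hH Dt β ι d₁ hy
  obtain ⟨hrd, hrK⟩ := analyticRank_twin_and_baseChange_of_rankOne W K Dt β ι d₁ (Cd • W.quadraticTwist (NumberField.discr K : ℚ))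
    (hGZ _ W K) hmod hK hH hr hy ⟨Cd, rfl⟩
  obtain ⟨-, hshaV, q, hq, hval⟩ := exists_shaAnOverC_baseChange_padicValRat_eq_C W K Dt β ι d₁ (hGZ _ W K) hGZK hmod hρ2 hc hK hodd
    h3 hH hrK hdiv hndiv
  obtain ⟨q', hq', hle⟩ := (missingLowerBoundAt_iff_lowerOverC_baseChange W 2 K (Cd • W.quadraticTwist (NumberField.discr K : ℚ)) hGZK
    hmod hMilneC hr.le hK.1 ⟨Cd, rfl⟩ (by rw [hrd]; exact zero_le_one) hBd).mp hL
  have hqq : q' = q := by exact_mod_cast hq'.symm.trans hq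
  rw [hqq, hval, hshaV] at hle
  linarith



/-! ### §2 On the slice: each half of `BSD₂` ⟺ the corresponding one-sided K-binder (odd-torsion form) -/

/-- **The Euler-system half on the slice from the `≤`-binder CARRYING the slice's odd-torsion hypothesis** (`hXU'`; the form in which
the converse delivers it) — as `missingUpperBoundAt_two_onSlice_of_shaUpperCAtTwo` (`…OneDoorHalvesKSlice.lean`), same assembly.
Conditional by design. [cite: GrossLMS1991, Thm. 1.3 and §4] -/
theorem missingUpperBoundAt_two_onSlice_of_shaUpperCAtTwo'
    (hGZ : ∀ (N : ℕ) [NeZero N] (W : WeierstrassCurve ℚ) (K : Type) [Field K] [NumberField K], gross_zagier N W K)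
    (hGZK : rank_eq_analyticRank_of_analyticRank_le_one) (hnf : exists_isNewformOf)
    (hHL : HoffsteinLuo1997_exists_twist_L_one_ne_zero) (hMilneC : Milne1972.bsdQuotient_baseChange_quadratic_anyModel)
    (hXU' : ∀ (W : WeierstrassCurve ℚ) [W.IsElliptic] [W.IsGloballyMinimal] [NeZero (W.conductorNorm ℤ)],
      ¬ W.HasCM → (∀ n : ℕ, W.HasSurjectiveModNGaloisRep ((2 ^ n : ℕ) : ℤ)) → Odd W.torsionOrder → Odd W.tamagawaProduct →
      W.analyticRank = 1 →
      ∀ (K : Type) [Field K] [NumberField K], IsImaginaryQuadratic K → Odd (NumberField.discr K) →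
        NumberField.discr K ≠ -3 → SatisfiesHeegnerHypothesis (W.conductorNorm ℤ) K →
        ¬ IsSquare ((NumberField.discr K : ℚ) * -|W.Δ|) → ¬ IsSquare ((NumberField.discr K : ℚ) * (-(2 * |W.Δ|))) →
        ∀ (Dt : ModularParametrizationData W (W.conductorNorm ℤ)) (β : ℤ) (ι : K →+* ℂ) (d₁ : KolyvaginHeegnerData Dt β ι 1),
          ¬ IsOfFinAddOrder d₁.derivedPoint → ∀ (M₀ : ℕ),
          (∃ Q : (W.baseChange (ringClassField K ι 1)).toAffine.Point, ((2 ^ M₀ : ℕ) : ℤ) • Q = d₁.derivedPoint) →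
          (¬ ∃ Q : (W.baseChange (ringClassField K ι 1)).toAffine.Point, ((2 ^ (M₀ + 1) : ℕ) : ℤ) • Q = d₁.derivedPoint) →
          (padicValNat 2 (Nat.card (AddCommGroup.primaryComponent (W.baseChange K).sha 2)) : ℤ) + 2 * padicValInt 2 Dt.c ≤ 2 * M₀)
    (hZ : S_rankZeroTwin) :
    ∀ (W : WeierstrassCurve ℚ) [W.IsElliptic] [W.IsGloballyMinimal], ¬ W.HasCM →
      (∀ n : ℕ, W.HasSurjectiveModNGaloisRep ((2 ^ n : ℕ) : ℤ)) → Odd W.torsionOrder → Odd W.tamagawaProduct →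
      W.analyticRank = 1 → MissingUpperBoundAt W 2 := by
  intro W _ _ hCM hsurj hT hc hr
  haveI hN : NeZero (W.conductorNorm ℤ) := ⟨(W.conductorNorm_pos_holds).ne'⟩
  have hmod : hasEntireLFunction_rat := hasEntireLFunction_rat_of_exists_isNewformOf hnf
  obtain ⟨K, _iF, _iN, hK, hodd, h3, hH, hsq1, hsq2, Dt, β, ι, d₁, M₀, hy, hdiv, hndiv⟩ :=
    exists_kolyvaginDoorDatum_of_onSlice hGZ hnf hHL W hr
  have hshaU := hXU' W hCM hsurj hT hc hr K hK hodd h3 hH hsq1 hsq2 Dt β ι d₁ hy M₀ hdiv hndiv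
  exact missingUpperBoundAt_two_of_shaUpperC_at hGZ hGZK hmod hMilneC hZ W hCM hsurj hc hr K hK hodd h3 hH Dt β ι d₁ hy M₀ hdiv hndiv
    hshaU

/-- **The main-conjecture half on the slice from the `≥`-binder carrying the odd-torsion hypothesis** (`hXL'`).  Conditional by design.
[cite: GrossLMS1991, §2 Conj. (2.2) and §4] -/
theorem missingLowerBoundAt_two_onSlice_of_shaLowerCAtTwo'
    (hGZ : ∀ (N : ℕ) [NeZero N] (W : WeierstrassCurve ℚ) (K : Type) [Field K] [NumberField K], gross_zagier N W K)
    (hGZK : rank_eq_analyticRank_of_analyticRank_le_one) (hnf : exists_isNewformOf)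
    (hHL : HoffsteinLuo1997_exists_twist_L_one_ne_zero) (hMilneC : Milne1972.bsdQuotient_baseChange_quadratic_anyModel)
    (hXL' : ∀ (W : WeierstrassCurve ℚ) [W.IsElliptic] [W.IsGloballyMinimal] [NeZero (W.conductorNorm ℤ)],
      ¬ W.HasCM → (∀ n : ℕ, W.HasSurjectiveModNGaloisRep ((2 ^ n : ℕ) : ℤ)) → Odd W.torsionOrder → Odd W.tamagawaProduct →
      W.analyticRank = 1 →
      ∀ (K : Type) [Field K] [NumberField K], IsImaginaryQuadratic K → Odd (NumberField.discr K) →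
        NumberField.discr K ≠ -3 → SatisfiesHeegnerHypothesis (W.conductorNorm ℤ) K →
        ¬ IsSquare ((NumberField.discr K : ℚ) * -|W.Δ|) → ¬ IsSquare ((NumberField.discr K : ℚ) * (-(2 * |W.Δ|))) →
        ∀ (Dt : ModularParametrizationData W (W.conductorNorm ℤ)) (β : ℤ) (ι : K →+* ℂ) (d₁ : KolyvaginHeegnerData Dt β ι 1),
          ¬ IsOfFinAddOrder d₁.derivedPoint → ∀ (M₀ : ℕ),
          (∃ Q : (W.baseChange (ringClassField K ι 1)).toAffine.Point, ((2 ^ M₀ : ℕ) : ℤ) • Q = d₁.derivedPoint) →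
          (¬ ∃ Q : (W.baseChange (ringClassField K ι 1)).toAffine.Point, ((2 ^ (M₀ + 1) : ℕ) : ℤ) • Q = d₁.derivedPoint) →
          2 * (M₀ : ℤ) ≤ (padicValNat 2 (Nat.card (AddCommGroup.primaryComponent (W.baseChange K).sha 2)) : ℤ) + 2 * padicValInt 2 Dt.c)
    (hZ : S_rankZeroTwin) :
    ∀ (W : WeierstrassCurve ℚ) [W.IsElliptic] [W.IsGloballyMinimal], ¬ W.HasCM →
      (∀ n : ℕ, W.HasSurjectiveModNGaloisRep ((2 ^ n : ℕ) : ℤ)) → Odd W.torsionOrder → Odd W.tamagawaProduct →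
      W.analyticRank = 1 → MissingLowerBoundAt W 2 := by
  intro W _ _ hCM hsurj hT hc hr
  haveI hN : NeZero (W.conductorNorm ℤ) := ⟨(W.conductorNorm_pos_holds).ne'⟩
  have hmod : hasEntireLFunction_rat := hasEntireLFunction_rat_of_exists_isNewformOf hnf
  obtain ⟨K, _iF, _iN, hK, hodd, h3, hH, hsq1, hsq2, Dt, β, ι, d₁, M₀, hy, hdiv, hndiv⟩ :=
    exists_kolyvaginDoorDatum_of_onSlice hGZ hnf hHL W hr
  have hshaL := hXL' W hCM hsurj hT hc hr K hK hodd h3 hH hsq1 hsq2 Dt β ι d₁ hy M₀ hdiv hndiv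
  exact missingLowerBoundAt_two_of_shaLowerC_at hGZ hGZK hmod hMilneC hZ W hCM hsurj hc hr K hK hodd h3 hH Dt β ι d₁ hy M₀ hdiv hndiv
    hshaL

/-- **LOSSLESSNESS OF THE SPLIT, EULER-SYSTEM HALF, BY NAME**: modulo PRINT (Gross–Zagier, GZK, modularity as a newform, Hoffstein–Luo 1997,
Milne 1972) and rank-`0` `BSD₂` of non-CM curves, «`ord₂ #Ш(W) ≤ ord₂ #Ш_an(W)` for every `W` on the slice of 23715» is EQUIVALENT to
Kolyvagin's upper bound at `2` over `K`, c-corrected, at conductor `1`, on the slice's Kolyvagin-admissible doors (binder of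
`missingUpperBoundAt_two_onSlice_of_shaUpperCAtTwo'`).  Conditional by design; BSD is not proved by this.
[cite: GrossLMS1991, Thm. 1.3, §2 Conj. (2.2) and §4] [cite: Milne1972ArithmeticAV, §1 Thm. 1] -/
theorem missingUpperBoundAt_onSlice_iff_shaUpperCAtTwo
    (hGZ : ∀ (N : ℕ) [NeZero N] (W : WeierstrassCurve ℚ) (K : Type) [Field K] [NumberField K], gross_zagier N W K)
    (hGZK : rank_eq_analyticRank_of_analyticRank_le_one) (hnf : exists_isNewformOf)
    (hHL : HoffsteinLuo1997_exists_twist_L_one_ne_zero) (hMilneC : Milne1972.bsdQuotient_baseChange_quadratic_anyModel)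
    (hZ : S_rankZeroTwin) :
    (∀ (W : WeierstrassCurve ℚ) [W.IsElliptic] [W.IsGloballyMinimal], ¬ W.HasCM →
      (∀ n : ℕ, W.HasSurjectiveModNGaloisRep ((2 ^ n : ℕ) : ℤ)) → Odd W.torsionOrder → Odd W.tamagawaProduct →
      W.analyticRank = 1 → MissingUpperBoundAt W 2) ↔
      ∀ (W : WeierstrassCurve ℚ) [W.IsElliptic] [W.IsGloballyMinimal] [NeZero (W.conductorNorm ℤ)],
        ¬ W.HasCM → (∀ n : ℕ, W.HasSurjectiveModNGaloisRep ((2 ^ n : ℕ) : ℤ)) → Odd W.torsionOrder → Odd W.tamagawaProduct →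
        W.analyticRank = 1 →
        ∀ (K : Type) [Field K] [NumberField K], IsImaginaryQuadratic K → Odd (NumberField.discr K) →
          NumberField.discr K ≠ -3 → SatisfiesHeegnerHypothesis (W.conductorNorm ℤ) K →
          ¬ IsSquare ((NumberField.discr K : ℚ) * -|W.Δ|) → ¬ IsSquare ((NumberField.discr K : ℚ) * (-(2 * |W.Δ|))) →
          ∀ (Dt : ModularParametrizationData W (W.conductorNorm ℤ)) (β : ℤ) (ι : K →+* ℂ) (d₁ : KolyvaginHeegnerData Dt β ι 1),
            ¬ IsOfFinAddOrder d₁.derivedPoint → ∀ (M₀ : ℕ),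
            (∃ Q : (W.baseChange (ringClassField K ι 1)).toAffine.Point, ((2 ^ M₀ : ℕ) : ℤ) • Q = d₁.derivedPoint) →
            (¬ ∃ Q : (W.baseChange (ringClassField K ι 1)).toAffine.Point, ((2 ^ (M₀ + 1) : ℕ) : ℤ) • Q = d₁.derivedPoint) →
            (padicValNat 2 (Nat.card (AddCommGroup.primaryComponent (W.baseChange K).sha 2)) : ℤ) + 2 * padicValInt 2 Dt.c ≤ 2 * M₀ :=
  ⟨fun hU W _ _ _ hCM hsurj hTo hc hr K _ _ hK hodd h3 hH _ _ Dt β ι d₁ hy M₀ hdiv hndiv =>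
      card_sha_baseChange_le_C_of_missingUpperBoundAt hGZ hGZK (hasEntireLFunction_rat_of_exists_isNewformOf hnf) hMilneC hZ W hCM hsurj hc
        hr K hK hodd h3 hH Dt β ι d₁ hy M₀ hdiv hndiv (hU W hCM hsurj hTo hc hr),
    fun hXU' => missingUpperBoundAt_two_onSlice_of_shaUpperCAtTwo' hGZ hGZK hnf hHL hMilneC hXU' hZ⟩

/-- **LOSSLESSNESS OF THE SPLIT, MAIN-CONJECTURE HALF, BY NAME**: modulo the same PRINT and rank-`0` `BSD₂`,
«`ord₂ #Ш_an(W) ≤ ord₂ #Ш(W)` on the slice» ⟺ the reverse K-inequality `2·M₀ ≤ ord₂ #Ш(E_K)[2^∞] + 2·v₂(c)` on the same doors.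
Conditional by design. [cite: GrossLMS1991, §2 Conj. (2.2) and §4] [cite: Milne1972ArithmeticAV, §1 Thm. 1] -/
theorem missingLowerBoundAt_onSlice_iff_shaLowerCAtTwo
    (hGZ : ∀ (N : ℕ) [NeZero N] (W : WeierstrassCurve ℚ) (K : Type) [Field K] [NumberField K], gross_zagier N W K)
    (hGZK : rank_eq_analyticRank_of_analyticRank_le_one) (hnf : exists_isNewformOf)
    (hHL : HoffsteinLuo1997_exists_twist_L_one_ne_zero) (hMilneC : Milne1972.bsdQuotient_baseChange_quadratic_anyModel)
    (hZ : S_rankZeroTwin) :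
    (∀ (W : WeierstrassCurve ℚ) [W.IsElliptic] [W.IsGloballyMinimal], ¬ W.HasCM →
      (∀ n : ℕ, W.HasSurjectiveModNGaloisRep ((2 ^ n : ℕ) : ℤ)) → Odd W.torsionOrder → Odd W.tamagawaProduct →
      W.analyticRank = 1 → MissingLowerBoundAt W 2) ↔
      ∀ (W : WeierstrassCurve ℚ) [W.IsElliptic] [W.IsGloballyMinimal] [NeZero (W.conductorNorm ℤ)],
        ¬ W.HasCM → (∀ n : ℕ, W.HasSurjectiveModNGaloisRep ((2 ^ n : ℕ) : ℤ)) → Odd W.torsionOrder → Odd W.tamagawaProduct →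
        W.analyticRank = 1 →
        ∀ (K : Type) [Field K] [NumberField K], IsImaginaryQuadratic K → Odd (NumberField.discr K) →
          NumberField.discr K ≠ -3 → SatisfiesHeegnerHypothesis (W.conductorNorm ℤ) K →
          ¬ IsSquare ((NumberField.discr K : ℚ) * -|W.Δ|) → ¬ IsSquare ((NumberField.discr K : ℚ) * (-(2 * |W.Δ|))) →
          ∀ (Dt : ModularParametrizationData W (W.conductorNorm ℤ)) (β : ℤ) (ι : K →+* ℂ) (d₁ : KolyvaginHeegnerData Dt β ι 1),
            ¬ IsOfFinAddOrder d₁.derivedPoint → ∀ (M₀ : ℕ),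
            (∃ Q : (W.baseChange (ringClassField K ι 1)).toAffine.Point, ((2 ^ M₀ : ℕ) : ℤ) • Q = d₁.derivedPoint) →
            (¬ ∃ Q : (W.baseChange (ringClassField K ι 1)).toAffine.Point, ((2 ^ (M₀ + 1) : ℕ) : ℤ) • Q = d₁.derivedPoint) →
            2 * (M₀ : ℤ) ≤ (padicValNat 2 (Nat.card (AddCommGroup.primaryComponent (W.baseChange K).sha 2)) : ℤ) + 2 * padicValInt 2 Dt.c :=
  ⟨fun hL W _ _ _ hCM hsurj hTo hc hr K _ _ hK hodd h3 hH _ _ Dt β ι d₁ hy M₀ hdiv hndiv =>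
      card_sha_baseChange_ge_C_of_missingLowerBoundAt hGZ hGZK (hasEntireLFunction_rat_of_exists_isNewformOf hnf) hMilneC hZ W hCM hsurj hc
        hr K hK hodd h3 hH Dt β ι d₁ hy M₀ hdiv hndiv (hL W hCM hsurj hTo hc hr),
    fun hXL' => missingLowerBoundAt_two_onSlice_of_shaLowerCAtTwo' hGZ hGZK hnf hHL hMilneC hXL' hZ⟩

end Summit.BirchSwinnertonDyer.BirchSwinnertonDyer.Theorems.RankOneAtTwoOneDoor

end
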